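import Summits.HodgeConjecture.HodgeConjecture.Theorems.Ring2WeilCoverageLatticeNormTwist
import Summits.HodgeConjecture.HodgeConjecture.Theorems.Ring2WeilCoverageCyclotomicTwistedLevelsIff
import Summits.HodgeConjecture.HodgeConjecture.Theorems.Ring2WeilCoverageCyclotomicUnitProducts
import HarnessLib

/-!
# Weil-type family coverage — level `M = 39`, the NON-PRINCIPAL lattice class: the prime `𝔔 = (1 − ζ³, 4 + ζ¹³)` over
# `13` has `𝔔𝔔^ρ = (α)`, `α = ζ¹⁷(1 − ζ²)(1 − ζ⁴²) ∈ ℚ(ζ₃₉)⁺` negative at exactly THREE places of each `χ₁₃`-class, so the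
# verdict FLIPS: `ℂ^Φ/Φ(𝔔)` is principally polarisable iff both twisted counts are ODD — and `𝔔` is not principal

research route conditional on HC_CM; not a corollary; Q11.4-sentence-2 already refuted in dim ≥ 3.

Ring 2, WEIL-TYPE FAMILY-COVERAGE CENSUS (`HOME/WEIL-FAMILY-COVERAGE.md` `## b01`, block b01.39 (F) «NOT CLAIMED: the non-principal
lattice class at `39/56`», owner ring2-b01), part 43 of the `Ring2WeilCoverage*` series.  `h(ℚ(ζ₃₉)) = 2`: besides
`ℂ^Φ/Φ(ℤ[ζ₃₉])` (parts 36/40/41) every simple CM abelian variety with CM by `ℤ[ζ₃₉]` and type `Φ` is `ℂ^Φ/Φ(𝔪)` for ONE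
more lattice class.  This file decides that class, hypothesis-free, with the twist principle of part 42:

* §1 the element `α = ζ¹⁷(1 − ζ²)(1 − ζ⁴²)` (`= −ζ¹⁷(1 − ζ²)(1 − ζ³)·…`; part 13's normalisation `2h + a + b = 78`):
  `σ_t(α) = −4 sin(2πt/39) sin(42πt/39)` is real, non-zero, NEGATIVE iff `39 < 2t mod 78 ↔ 39 < 42t mod 78`
  (`alpha_read`), i.e. iff `t ∈ A = {2,4,8,10,17,19,20,22,29,31,35,37}`; `α^ρ = α ≠ 0`.
* §2 `card_filter_negA_plus/_minus`: **every CM-type set meets `A ∩ C₊ = {4,10,17,22,29,35}` and `A ∩ C₋ = {2,8,19,20,31,37}`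
  in exactly `3` residues** (three symmetric pairs each; part 42 `two_mul_card_inter_eq`).
* §3 **`principal_iff_odd_of_mul_conjIdeal_eq` (THE FLIPPED LAW)**: for ANY lattice `𝔪` with `𝔪𝔪^ρ = (α)` and any CM type
  `Φ`: `ℂ^Φ/D(𝔪)` carries an `ι`-compatible principal polarisation (`∃ ζ′`, `ζ′^ρ = −ζ′`, `Im φ(ζ′) > 0` on `Φ`,
  `IsOfType 𝔪 ζ′ ⊤`) **iff `|S_Φ ∩ C₊ ∩ N_odd|` and `|S_Φ ∩ C₋ ∩ N_odd|` are both ODD** — part 41's `principal_iff_thirtyNine`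
  for the twisted type `Φ_α`, whose counts are shifted by `3` and `3`.
* §4 the lattice: `𝔔 = (1 − ζ³, 4 + ζ¹³) ⊂ 𝓞 K` (a prime over `13 = (4 + ω)(4 + ω̄)`, `ω = ζ¹³`), `𝔔^ρ = (1 − ζ³⁶, 4 + ζ²⁶)`,
  **`𝔔𝔔^ρ = (α)`** (`span_mul_map_conj_eq`: four explicit quotients in `ℤ[ζ]` and `α = 2ζ¹⁷(1−ζ²)(1−ζ³)(4+ζ²⁶) − …`, all
  `linear_combination` mod `Φ₃₉`); so **`principal_iff_odd_thirtyNine_nonprincipal`**: the flipped law on `ℂ^Φ/Φ(𝔔)`; and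
  **`not_isPrincipal_thirtyNine`: `𝔔` is NOT principal** — a principal lattice repeats the verdict of `ℤ[ζ₃₉]` (part 42 §4),
  but at the CM type with `S_Φ = N_odd` the two verdicts differ.  (So `h(ℚ(ζ₃₉)) > 1` in the kernel, by signatures.)
* §5 `exists_principal_on_some_lattice_thirtyNine`: for EVERY CM type `Φ` whose two twisted counts have the same parity —
  in particular every `K`-balanced `Φ` of the six census rows (b01.39 (D)) — a principally polarised `ℂ^Φ/Φ(𝔪)`,
  `𝔪 ∈ {ℤ[ζ₃₉], 𝔔}`, EXISTS: the census's «452 NO» classes at `(39, ℚ(√−3))`, `(39, ℚ(√−39))` are NO on `ℤ[ζ₃₉]` and YES on `𝔔`.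

HONEST FRAMING: statements about Shimura's divisors of principal type on the principal CM tori `ℂ^Φ/D(𝔪)`, `𝔪𝔪^ρ = (α)`;
that `{ℤ[ζ₃₉], 𝔔}` exhausts the lattice classes is `h(ℚ(ζ₃₉)) = 2` [Washington1997, tables §11] and is NOT proved here (only
`[𝔔] ≠ 1`); nothing about Hodge classes, `W_K`, general members or HC; `HC_CM` is used nowhere.  No `def`, no named fact,
no `sorry`.  References: [cite: Shimura1998, §14.3 Prop. 4–5, pp. 103–104; §14.4 Prop. 7, p. 105]; [cite: Washington1997,
§8.1, Prop. 2.8, tables §11 (h(ℚ(ζ₃₉)) = 2)]; census b01.25 (A), b01.39 (seat-derived); certificates `g60/py/cert_np39.py`.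
-/

noncomputable section

open Polynomial NumberField NumberField.ComplexEmbedding Complex Finset FractionalIdeal
open scoped nonZeroDivisors Real

namespace Summit.HodgeConjecture.Ring2WeilCoverage.NonPrincipalLatticeLevel39

open Literature.AlgebraicGeometry.Motives (CMType)
open Literature.AlgebraicGeometry.HodgeTheory (IsCMTypeSet)
open Literature.AlgebraicGeometry.ComplexMultiplication.CyclotomicCMType
open Literature.NumberTheory.ComplexMultiplication
open Literature.NumberTheory.NumberFields
open Summit.HodgeConjecture.Ring2WeilCoverage.LatticeNormTwist
open Summit.HodgeConjecture.Ring2WeilCoverage.CyclotomicTwistedLevel39 (nodd_thirtyNine_eq classes_thirtyNine)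
open Summit.HodgeConjecture.Ring2WeilCoverage.CyclotomicTwistedLevelsIff (principal_iff_thirtyNine)
open Summit.HodgeConjecture.Ring2WeilCoverage.CyclotomicUnitProducts (re_embedding_gen)
open Summit.HodgeConjecture.Ring2WeilCoverage.RealQuadraticUnitNorm (complexConj_eq_inv_of_pow_eq_one)

variable {K : Type} [Field K] [NumberField K] [IsCMField K] {ζ : K}

/-- `𝐞(t) = exp(2πi t/39) ∈ ℂ` (`ZMod.toCircle`). -/
local notation3 (prettyPrint := false) "𝐞 " t:max => ((ZMod.toCircle t : Circle) : ℂ)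
/-- the residue set `S_Φ` of a CM type. -/
local notation3 (prettyPrint := false) "𝐒 " Φ:max =>
  (Finset.univ.filter fun t : ZMod 39 => ∃ σ ∈ (Φ : CMType K).1, σ ζ = 𝐞 t)
/-- `N_odd` at `39` as a filter (parts 36/41). -/
local notation3 (prettyPrint := false) "Nodd39" =>
  (Finset.univ.filter fun t : ZMod 39 => t.val.Coprime 39 ∧
    Even (Finset.card (Finset.filter (fun s : ZMod 39 => s.val.Coprime 39 ∧ s.val < t.val) Finset.univ)))
/-- `C₊ = {χ₁₃ = +1}` at `39`. -/
local notation3 (prettyPrint := false) "Cp39" => ({1, 4, 10, 14, 16, 17, 22, 23, 25, 29, 35, 38} : Finset (ZMod 39))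
/-- the sign predicate of `α`: `39 < 2t mod 78 ↔ 39 < 42t mod 78`. -/
local notation3 (prettyPrint := false) "negA " t:max =>
  (39 < 2 * ZMod.val (t : ZMod 39) % (2 * 39) ↔ 39 < 42 * ZMod.val (t : ZMod 39) % (2 * 39))
/-- `α = ζ¹⁷(1 − ζ²)(1 − ζ⁴²)`. -/
local notation3 (prettyPrint := false) "α" => (ζ ^ 17 * (1 - ζ ^ 2) * (1 - ζ ^ 42))
/-- the lattice `𝔔 = (1 − ζ³, 4 + ζ¹³) ⊂ 𝓞 K`. -/
local notation3 (prettyPrint := false) "𝔔[" hζ "]" =>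
  (Ideal.span {1 - IsPrimitiveRoot.toInteger hζ ^ 3, 4 + IsPrimitiveRoot.toInteger hζ ^ 13} : Ideal (𝓞 K))

/-! ### §1 The element `α` -/

omit [NumberField K] [IsCMField K] in
/-- **`σ_t(α)` is real, non-zero, and negative iff `39 < 2t mod 78 ↔ 39 < 42t mod 78`** (part 13 `re_embedding_gen` with
`(a, b, h) = (2, 42, 17)`, `2h + a + b = 78`).
research route conditional on HC_CM; not a corollary; Q11.4-sentence-2 already refuted in dim ≥ 3. [cite: Washington1997, §8.1] -/
theorem alpha_read {σ : K →+* ℂ} {t : ZMod 39} (ht : t.val.Coprime 39) (hσ : σ ζ = 𝐞 t) :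
    ((σ α).re < 0 ↔ negA t) ∧ (σ α).re ≠ 0 ∧ (σ α).im = 0 :=
  re_embedding_gen (n := 39) hσ ht (by decide) (by decide) (by decide)

/-- **`α ∈ ℚ(ζ₃₉)⁺`, `α ≠ 0`.**
research route conditional on HC_CM; not a corollary; Q11.4-sentence-2 already refuted in dim ≥ 3. [folklore] -/
theorem alpha_real_ne_zero (hζ : IsPrimitiveRoot ζ 39) : IsCMField.complexConj K α = α ∧ α ≠ 0 := by
  obtain ⟨φ⟩ := (inferInstance : Nonempty (K →+* ℂ))
  obtain ⟨t, ht, hφ⟩ := exists_apply_eq_toCircle hζ φ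
  obtain ⟨-, hne, him⟩ := alpha_read ht hφ
  refine ⟨φ.injective ?_, fun h => hne (by rw [h, map_zero, Complex.zero_re])⟩
  rw [IsCMField.complexEmbedding_complexConj]
  exact Complex.ext (by rw [Complex.conj_re]) (by rw [Complex.conj_im, him, neg_zero])

omit [NumberField K] [IsCMField K] in
/-- The read in the form used by part 42: «`Re σ(α) < 0 ↔ negA t`» whenever `σ ζ = 𝐞(t)`. [folklore] -/
theorem alpha_read' : ∀ (σ : K →+* ℂ) (t : ZMod 39), t.val.Coprime 39 → σ ζ = 𝐞 t → ((σ α).re < 0 ↔ negA t) :=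
  fun _ _ ht hσ => (alpha_read ht hσ).1

/-! ### §2 The constants: `A ∩ C₊` and `A ∩ C₋` are three symmetric pairs each -/

/-- The decidable facts: on units, `t ∈ C₊ ∧ negA t ↔ t ∈ {4,10,17,22,29,35}` and `t ∉ C₊ ∧ negA t ↔ t ∈ {2,8,19,20,31,37}`;
both sets consist of units and are symmetric; `C₊` and its complement are symmetric; the counts at `S = N_odd`. [folklore] -/
theorem negA_facts :
    (∀ t : ZMod 39, t.val.Coprime 39 → ((t ∈ Cp39 ∧ negA t) ↔ t ∈ ({4, 10, 17, 22, 29, 35} : Finset (ZMod 39)))) ∧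
    (∀ t : ZMod 39, t.val.Coprime 39 → ((t ∉ Cp39 ∧ negA t) ↔ t ∈ ({2, 8, 19, 20, 31, 37} : Finset (ZMod 39)))) ∧
    (∀ t ∈ ({4, 10, 17, 22, 29, 35} : Finset (ZMod 39)), t.val.Coprime 39 ∧ -t ∈ ({4, 10, 17, 22, 29, 35} : Finset (ZMod 39))) ∧
    (∀ t ∈ ({2, 8, 19, 20, 31, 37} : Finset (ZMod 39)), t.val.Coprime 39 ∧ -t ∈ ({2, 8, 19, 20, 31, 37} : Finset (ZMod 39))) ∧
    (∀ t ∈ Cp39, -t ∈ Cp39) ∧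
    (∀ t ∈ (Finset.univ.filter fun t : ZMod 39 => t ∉ Cp39), -t ∈ (Finset.univ.filter fun t : ZMod 39 => t ∉ Cp39)) := by
  refine ⟨by decide, by decide, by decide, by decide, by decide, by decide⟩

/-- **`|{t ∈ S ∩ C₊ : negA t}| = 3`** for every CM-type set `S`.
research route conditional on HC_CM; not a corollary; Q11.4-sentence-2 already refuted in dim ≥ 3. [folklore] -/
theorem card_filter_negA_plus {S : Finset (ZMod 39)} (hS : IsCMTypeSet 39 S) :
    ((S ∩ Cp39).filter fun t => negA t).card = 3 := by
  obtain ⟨h1, -, h3, -, -, -⟩ := negA_facts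
  have hset : ((S ∩ Cp39).filter fun t => negA t) = S ∩ ({4, 10, 17, 22, 29, 35} : Finset (ZMod 39)) := by
    ext t
    simp only [Finset.mem_filter, Finset.mem_inter]
    constructor
    · rintro ⟨⟨htS, htC⟩, hN⟩
      exact ⟨htS, (h1 t (hS.1 t htS)).mp ⟨htC, hN⟩⟩
    · rintro ⟨htS, htD⟩
      obtain ⟨htC, hN⟩ := (h1 t (hS.1 t htS)).mpr htD
      exact ⟨⟨htS, htC⟩, hN⟩
  have h := two_mul_card_inter_eq hS h3
  rw [hset]
  have : ({4, 10, 17, 22, 29, 35} : Finset (ZMod 39)).card = 6 := by decide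
  omega

/-- **`|{t ∈ S ∩ C₋ : negA t}| = 3`** for every CM-type set `S` (`C₋` = the complement of `C₊`).
research route conditional on HC_CM; not a corollary; Q11.4-sentence-2 already refuted in dim ≥ 3. [folklore] -/
theorem card_filter_negA_minus {S : Finset (ZMod 39)} (hS : IsCMTypeSet 39 S) :
    ((S ∩ (Finset.univ.filter fun t : ZMod 39 => t ∉ Cp39)).filter fun t => negA t).card = 3 := by
  obtain ⟨-, h2, -, h4, -, -⟩ := negA_facts
  have hset : ((S ∩ (Finset.univ.filter fun t : ZMod 39 => t ∉ Cp39)).filter fun t => negA t) =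
      S ∩ ({2, 8, 19, 20, 31, 37} : Finset (ZMod 39)) := by
    ext t
    simp only [Finset.mem_filter, Finset.mem_inter, Finset.mem_univ, true_and]
    constructor
    · rintro ⟨⟨htS, htC⟩, hN⟩
      exact ⟨htS, (h2 t (hS.1 t htS)).mp ⟨htC, hN⟩⟩
    · rintro ⟨htS, htD⟩
      obtain ⟨htC, hN⟩ := (h2 t (hS.1 t htS)).mpr htD
      exact ⟨⟨htS, htC⟩, hN⟩
  have h := two_mul_card_inter_eq hS h4
  rw [hset]
  have : ({2, 8, 19, 20, 31, 37} : Finset (ZMod 39)).card = 6 := by decide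
  omega

/-! ### §3 The flipped law for every lattice with `𝔪𝔪^ρ = (α)` -/

open scoped Classical in
/-- **THE FLIPPED LAW AT `39`.**  For any `K` with `IsCyclotomicExtension {39} ℚ K`, `[IsCMField K]`, `ζ` a primitive 39th
root of unity, ANY lattice `𝔪` with `𝔪𝔪^ρ = (α)`, `α = ζ¹⁷(1 − ζ²)(1 − ζ⁴²)`, and any CM type `Φ`: the principal CM torus
`ℂ^Φ/D(𝔪)` carries an `ι`-compatible PRINCIPAL polarisation **iff `|S_Φ ∩ N_odd ∩ C₊|` and `|S_Φ ∩ N_odd ∖ C₊|` are both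
ODD** — the negation, class by class, of the principal-lattice law `principal_iff_thirtyNine` (both EVEN).  Proof: twist
principle (part 42) + part 41 at `Φ_α` + §2.
research route conditional on HC_CM; not a corollary; Q11.4-sentence-2 already refuted in dim ≥ 3. [cite: Shimura1998, §14.3 Prop. 5, p. 104; §14.4 Prop. 7, p. 105] -/
theorem principal_iff_odd_of_mul_conjIdeal_eq [IsCyclotomicExtension {39} ℚ K] (hζ : IsPrimitiveRoot ζ 39)
    (Φ : CMType K) (𝔪 : (FractionalIdeal (𝓞 K)⁰ K)ˣ)
    (h𝔪 : (𝔪 : FractionalIdeal (𝓞 K)⁰ K) * (CMTypeLattice.conjIdeal 𝔪 : FractionalIdeal (𝓞 K)⁰ K) =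
      spanSingleton (𝓞 K)⁰ α) :
    (∃ ζ' : K, IsCMField.complexConj K ζ' = -ζ' ∧ (∀ φ : Φ.1, 0 < (φ.1 ζ').im) ∧
        CMTypeLattice.IsOfType 𝔪 ζ' ⊤) ↔
      (Odd (((𝐒 Φ ∩ Nodd39).filter fun t => t ∈ Cp39).card) ∧
        Odd (((𝐒 Φ ∩ Nodd39).filter fun t => t ∉ Cp39).card)) := by
  classical
  obtain ⟨hreal, h0⟩ := alpha_real_ne_zero hζ
  obtain ⟨Φ', hΦ'⟩ := exists_twist Φ hreal h0
  obtain ⟨-, -, -, -, hCp, hCc⟩ := negA_facts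
  obtain ⟨-, -, -, -, hNoddSet, -, -, -, -⟩ := classes_thirtyNine
  have hS := isCMTypeSet_residueFilter hζ Φ
  rw [exists_pos_isOfType_iff_twist Φ Φ' hreal h0 hΦ' 𝔪 h𝔪 ⊤, principal_iff_thirtyNine hζ Φ']
  -- filters as triple intersections
  have e1 : ∀ Ψ : CMType K, ((𝐒 Ψ ∩ Nodd39).filter fun t => t ∈ Cp39) = 𝐒 Ψ ∩ Cp39 ∩ Nodd39 := fun Ψ => by
    ext t; simp only [mem_filter, mem_inter]; tauto
  have e2 : ∀ Ψ : CMType K, ((𝐒 Ψ ∩ Nodd39).filter fun t => t ∉ Cp39) =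
      𝐒 Ψ ∩ (Finset.univ.filter fun t : ZMod 39 => t ∉ Cp39) ∩ Nodd39 := fun Ψ => by
    ext t; simp only [mem_filter, mem_inter, mem_univ, true_and]; tauto
  rw [e1, e2, e1, e2]
  have hN' : IsCMTypeSet 39 Nodd39 := by rw [nodd_thirtyNine_eq]; exact hNoddSet
  have h1 := card_twist_inter_inter_mod_two hζ Φ Φ' hreal h0 hΦ' (N := fun t => negA t) alpha_read' hCp hN'
  have h2 := card_twist_inter_inter_mod_two hζ Φ Φ' hreal h0 hΦ' (N := fun t => negA t) alpha_read' hCc hN'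
  rw [card_filter_negA_plus hS] at h1
  rw [card_filter_negA_minus hS] at h2
  rw [Nat.even_iff, Nat.even_iff, Nat.odd_iff, Nat.odd_iff]
  omega

/-! ### §4 The lattice `𝔔 = (1 − ζ³, 4 + ζ¹³)`: `𝔔𝔔^ρ = (α)`, the flipped law on `ℂ^Φ/Φ(𝔔)`, and `𝔔` is not principal -/

section Lattice

/-- The cyclotomic relations at `39`: `1 + ω + ω² = 0` (`ω = ζ¹³`), `Σ_{k<13} η^k = 0` (`η = ζ³`), `ζ³⁹ = 1`, `ζ^ρ = ζ³⁸`. [folklore] -/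
theorem relations_thirtyNine (hζ : IsPrimitiveRoot ζ 39) :
    1 + ζ ^ 13 + ζ ^ 26 = 0 ∧
    1 + ζ ^ 3 + ζ ^ 6 + ζ ^ 9 + ζ ^ 12 + ζ ^ 15 + ζ ^ 18 + ζ ^ 21 + ζ ^ 24 + ζ ^ 27 + ζ ^ 30 + ζ ^ 33 + ζ ^ 36 = 0 ∧
    ζ ^ 39 = 1 ∧ IsCMField.complexConj K ζ = ζ ^ 38 := by
  have h39 : ζ ^ 39 = 1 := hζ.pow_eq_one
  have hω : IsPrimitiveRoot (ζ ^ 13) 3 := hζ.pow (by norm_num) (by norm_num)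
  have hη : IsPrimitiveRoot (ζ ^ 3) 13 := hζ.pow (by norm_num) (by norm_num)
  have hA := hω.geom_sum_eq_zero (by norm_num : 1 < 3)
  have hB := hη.geom_sum_eq_zero (by norm_num : 1 < 13)
  simp only [Finset.sum_range_succ, Finset.sum_range_zero, zero_add, ← pow_mul] at hA hB
  refine ⟨by linear_combination hA, by linear_combination hB, h39, ?_⟩
  rw [complexConj_eq_inv_of_pow_eq_one (by norm_num) h39]
  exact inv_eq_of_mul_eq_one_right (by linear_combination h39)

/-- **`𝔔^ρ = (1 − ζ³⁶, 4 + ζ²⁶)`**: the image of `𝔔` under `ρ` restricted to `𝓞 K` (`ζ^ρ = ζ³⁸`, `ζ³⁹ = 1`). [folklore] -/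
theorem map_conj_span_eq (hζ : IsPrimitiveRoot ζ 39) :
    (𝔔[hζ]).map (AmbiguousClass.intAut (IsCMField.complexConj K) : 𝓞 K →+* 𝓞 K) =
      Ideal.span {1 - hζ.toInteger ^ 36, 4 + hζ.toInteger ^ 26} := by
  obtain ⟨-, -, h39, hc⟩ := relations_thirtyNine hζ
  have hzK : algebraMap (𝓞 K) K hζ.toInteger = ζ := rfl
  have h1 : (AmbiguousClass.intAut (IsCMField.complexConj K) : 𝓞 K →+* 𝓞 K) (1 - hζ.toInteger ^ 3) =
      1 - hζ.toInteger ^ 36 := by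
    apply RingOfIntegers.ext
    change IsCMField.complexConj K ((1 - hζ.toInteger ^ 3 : 𝓞 K) : K) = ((1 - hζ.toInteger ^ 36 : 𝓞 K) : K)
    push_cast
    simp only [map_sub, map_one, map_pow, hzK, hc]
    linear_combination (-(ζ ^ 75) - ζ ^ 36) * h39
  have h2 : (AmbiguousClass.intAut (IsCMField.complexConj K) : 𝓞 K →+* 𝓞 K) (4 + hζ.toInteger ^ 13) =
      4 + hζ.toInteger ^ 26 := by
    apply RingOfIntegers.ext
    change IsCMField.complexConj K ((4 + hζ.toInteger ^ 13 : 𝓞 K) : K) = ((4 + hζ.toInteger ^ 26 : 𝓞 K) : K)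
    push_cast
    simp only [map_add, map_ofNat, map_pow, hzK, hc]
    linear_combination (ζ ^ 455 + ζ ^ 416 + ζ ^ 377 + ζ ^ 338 + ζ ^ 299 + ζ ^ 260 + ζ ^ 221 + ζ ^ 182 + ζ ^ 143 +
      ζ ^ 104 + ζ ^ 65 + ζ ^ 26) * h39
  rw [Ideal.map_span, Set.image_pair, h1, h2]

/-- **`𝔔𝔔^ρ = (α)` in `𝓞 K`**: `(1 − ζ³, 4 + ζ¹³)(1 − ζ³⁶, 4 + ζ²⁶) = (ζ¹⁷(1 − ζ²)(1 − ζ⁴²))` — the four products are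
`α`-multiples with explicit quotients in `ℤ[ζ]`, and `α = 2ζ¹⁷(1−ζ²)·(1−ζ³)(4+ζ²⁶) − 2ζ²⁰(1−ζ²)·(4+ζ¹³)(1−ζ³⁶) −
ζ¹⁷(1−ζ²)(1−ζ³)·(4+ζ¹³)(4+ζ²⁶)` (all `linear_combination` mod `Φ₃₉`; certificates `g60/py/cert_np39.py`).
research route conditional on HC_CM; not a corollary; Q11.4-sentence-2 already refuted in dim ≥ 3. [folklore] -/
theorem span_mul_map_conj_eq (hζ : IsPrimitiveRoot ζ 39) :
    𝔔[hζ] * (𝔔[hζ]).map (AmbiguousClass.intAut (IsCMField.complexConj K) : 𝓞 K →+* 𝓞 K) =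
      Ideal.span {hζ.toInteger ^ 17 * (1 - hζ.toInteger ^ 2) * (1 - hζ.toInteger ^ 42)} := by
  obtain ⟨hA, hB, hM, -⟩ := relations_thirtyNine hζ
  have hzK : algebraMap (𝓞 K) K hζ.toInteger = ζ := rfl
  rw [map_conj_span_eq hζ, Ideal.span_pair_mul_span_pair]
  apply le_antisymm
  · -- each product is an `α`-multiple
    rw [Ideal.span_le]
    intro x hx
    simp only [Set.mem_insert_iff, Set.mem_singleton_iff] at hx
    rw [SetLike.mem_coe, Ideal.mem_span_singleton]
    rcases hx with rfl | rfl | rfl | rfl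
    · refine ⟨-1 + 2*hζ.toInteger - 2*hζ.toInteger^2 + hζ.toInteger^3 - hζ.toInteger^6 + 2*hζ.toInteger^7 - 2*hζ.toInteger^8 + hζ.toInteger^9 - hζ.toInteger^12 + hζ.toInteger^13 - hζ.toInteger^15 + hζ.toInteger^16 - hζ.toInteger^18 - 2*hζ.toInteger^21 +
        2*hζ.toInteger^22 - hζ.toInteger^23, RingOfIntegers.ext ?_⟩
      push_cast; simp only [map_ofNat, hzK]
      linear_combination ((-1 : K) * ζ ^ 5 + (1 : K) * ζ ^ 6 + (1 : K) * ζ ^ 17 + (-1 : K) * ζ ^ 18) * hA + ((1 : K) * ζ ^ 4 + (-1 : K) * ζ ^ 5 + (-1 : K) * ζ ^ 7 + (1 : K) * ζ ^ 8) * hB + ((-1 : K) + (1 : K) * ζ ^ 3 + (1 : K) * ζ ^ 4 + (-2 : K) * ζ ^ 5 + (1 : K) * ζ ^ 6 + (-1 : K) * ζ ^ 20 + (2 : K) * ζ ^ 21 + (-1 : K) * ζ ^ 22 + (-1 : K) * ζ ^ 23 + (2 : K) * ζ ^ 24 + (-1 : K) * ζ ^ 25 + (-1 : K) * ζ ^ 26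 + (2 : K) * ζ ^ 27 + (-1 : K) * ζ ^ 28 + (-1 : K) * ζ ^ 29 + (2 : K) * ζ ^ 30 + (-1 : K) * ζ ^ 31 + (-1 : K) * ζ ^ 32 + (1 : K) * ζ ^ 33 + (1 : K) * ζ ^ 34 + (-2 : K) * ζ ^ 35 + (1 : K) * ζ ^ 36 + (1 : K) * ζ ^ 37 + (-2 : K) * ζ ^ 38 + (1 : K) * ζ ^ 40 + (-2 : K) * ζ ^ 41 + (2 : K) * ζ ^ 42 + (1 : K) * ζ ^ 43 + (-2 : K) * ζ ^ 44 + (1 : K) * ζ ^ 45) * hM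
    · refine ⟨-4 + 3*hζ.toInteger - 3*hζ.toInteger^2 - hζ.toInteger^3 - 4*hζ.toInteger^6 + 3*hζ.toInteger^7 - 3*hζ.toInteger^8 + hζ.toInteger^11 - 4*hζ.toInteger^12 - 3*hζ.toInteger^15 - hζ.toInteger^16 + hζ.toInteger^17 - 4*hζ.toInteger^18 -
        3*hζ.toInteger^21 + 3*hζ.toInteger^22 + hζ.toInteger^23, RingOfIntegers.ext ?_⟩
      push_cast; simp only [map_ofNat, hzK]
      linear_combination ((-4 : K) * ζ ^ 5 + (-1 : K) * ζ ^ 6 + (4 : K) * ζ ^ 17 + (1 : K) * ζ ^ 18) * hA + ((4 : K) * ζ ^ 4 + (1 : K) * ζ ^ 5 + (-4 : K) * ζ ^ 7 + (-1 : K) * ζ ^ 8) * hB + ((-4 : K) + (4 : K) * ζ ^ 3 + (4 : K) * ζ ^ 4 + (-3 : K) * ζ ^ 5 + (-1 : K) * ζ ^ 6 + (-4 : K) * ζ ^ 20 + (3 : K) * ζ ^ 21 + (1 : K) * ζ ^ 22 + (-4 : K) * ζ ^ 23 + (3 : K) * ζ ^ 24 + (1 : K) * ζ ^ 25 + (-4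 : K) * ζ ^ 26 + (3 : K) * ζ ^ 27 + (1 : K) * ζ ^ 28 + (-3 : K) * ζ ^ 29 + (3 : K) * ζ ^ 30 + (1 : K) * ζ ^ 31 + (-4 : K) * ζ ^ 32 + (-1 : K) * ζ ^ 33 + (4 : K) * ζ ^ 34 + (-3 : K) * ζ ^ 35 + (-1 : K) * ζ ^ 36 + (4 : K) * ζ ^ 37 + (-3 : K) * ζ ^ 38 + (-1 : K) * ζ ^ 39 + (4 : K) * ζ ^ 40 + (-3 : K) * ζ ^ 41 + (3 : K) * ζ ^ 42 + (4 : K) * ζ ^ 43 + (-3 : K) * ζ ^ 44 + (-1 : K) * ζ ^ 45) * hM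
    · refine ⟨-1 + 4*hζ.toInteger - 4*hζ.toInteger^2 + 3*hζ.toInteger^3 + 4*hζ.toInteger^7 - 3*hζ.toInteger^8 + 3*hζ.toInteger^9 + hζ.toInteger^10 + 3*hζ.toInteger^13 + hζ.toInteger^14 - hζ.toInteger^15 + 4*hζ.toInteger^16 + hζ.toInteger^20 -
        4*hζ.toInteger^21 + 4*hζ.toInteger^22 - 3*hζ.toInteger^23, RingOfIntegers.ext ?_⟩
      push_cast; simp only [map_ofNat, hzK]
      linear_combination ((-1 : K) * ζ + (-1 : K) * ζ ^ 2 + (-1 : K) * ζ ^ 3 + (-1 : K) * ζ ^ 4 + (-2 : K) * ζ ^ 5 + (2 : K) * ζ ^ 6 + (-1 : K) * ζ ^ 7 + (-1 : K) * ζ ^ 8 + (-1 : K) * ζ ^ 9 + (-1 : K) * ζ ^ 10 + (1 : K) * ζ ^ 13 + (1 : K) * ζ ^ 14 + (1 : K) * ζ ^ 15 + (1 : K) * ζ ^ 16 + (2 : K) * ζ ^ 17 + (-2 : K) * ζ ^ 18 + (1 : K) * ζ ^ 19 + (1 : K) * ζ ^ 20 + (1 : K) * ζ ^ 21 + (1 :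 K) * ζ ^ 22) * hA + ((1 : K) + (1 : K) * ζ + (1 : K) * ζ ^ 2 + (1 : K) * ζ ^ 4 + (-3 : K) * ζ ^ 5 + (-1 : K) * ζ ^ 7 + (3 : K) * ζ ^ 8 + (-1 : K) * ζ ^ 10 + (-1 : K) * ζ ^ 11 + (-1 : K) * ζ ^ 12) * hB + ((-3 : K) + (1 : K) * ζ ^ 4 + (-4 : K) * ζ ^ 5 + (3 : K) * ζ ^ 6 + (-1 : K) * ζ ^ 10 + (-1 : K) * ζ ^ 20 + (4 : K) * ζ ^ 21 + (-3 : K) * ζ ^ 22 + (-1 : K) * ζ ^ 23 + (4 : K) * ζ ^ 24 + (-3 : K) * ζ ^ 25 + (4 : K) * ζ ^ 27 + (-3 : K) * ζ ^ 28 + (-1 : K) * ζ ^ 29 + (4 : K) * ζ ^ 30 + (-3 : K) * ζ ^ 31 + (-1 : K) * ζ ^ 32 + (3 : K) * ζ ^ 33 + (1 : K) * ζ ^ 34 + (-4 : K) * ζ ^ 35 + (3 : K) * ζ ^ 36 + (1 : K) * ζ ^ 37 + (-4 : K) * ζ ^ 38 + (1 : K) * ζ ^ 40 + (-4 : K) *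 ζ ^ 41 + (3 : K) * ζ ^ 42 + (1 : K) * ζ ^ 43 + (-4 : K) * ζ ^ 44 + (3 : K) * ζ ^ 45) * hM
    · refine ⟨13 + 4*hζ.toInteger - 8*hζ.toInteger^2 + 17*hζ.toInteger^3 - 5*hζ.toInteger^4 - 3*hζ.toInteger^5 + 8*hζ.toInteger^6 - hζ.toInteger^7 - 11*hζ.toInteger^8 + 12*hζ.toInteger^9 - 10*hζ.toInteger^10 - 6*hζ.toInteger^11 +
        3*hζ.toInteger^12 + 7*hζ.toInteger^13 - 10*hζ.toInteger^14 - hζ.toInteger^15 + 2*hζ.toInteger^16 - 14*hζ.toInteger^17 - 5*hζ.toInteger^18 - 3*hζ.toInteger^19 - 18*hζ.toInteger^20 - 9*hζ.toInteger^21 + 5*hζ.toInteger^22 -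
        22*hζ.toInteger^23, RingOfIntegers.ext ?_⟩
      push_cast; simp only [map_ofNat, hzK]
      linear_combination ((-5 : K) * ζ + (-5 : K) * ζ ^ 2 + (-4 : K) * ζ ^ 3 + (-5 : K) * ζ ^ 4 + (8 : K) * ζ ^ 5 + (13 : K) * ζ ^ 6 + (-9 : K) * ζ ^ 7 + (-9 : K) * ζ ^ 8 + (-9 : K) * ζ ^ 9 + (-9 : K) * ζ ^ 10 + (-9 : K) * ζ ^ 11 + (-9 : K) * ζ ^ 12 + (-4 : K) * ζ ^ 13 + (-3 : K) * ζ ^ 14 + (-4 : K) * ζ ^ 15 + (-4 : K) * ζ ^ 16 + (-16 : K) * ζ ^ 17 + (-21 : K) * ζ ^ 18 + (1 : K) * ζ ^ 20 + (1 : K) * ζ ^ 21 + (1 : K) * ζ ^ 23 + (1 : K) * ζ ^ 24) * hA + ((5 : K) + (5 : K) * ζ + (4 : K) * ζ ^ 2 + (-13 : K) * ζ ^ 4 + (-17 : K) * ζ ^ 5 + (4 : K) * ζ ^ 6 + (17 : K) * ζ ^ 7 + (22 : K) * ζ ^ 8 + (-1 : K) * ζ ^ 13 + (-1 : K) * ζ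 ^ 14) * hB + ((-11 : K) + (-1 : K) * ζ ^ 2 + (1 : K) * ζ ^ 3 + (-13 : K) * ζ ^ 4 + (-5 : K) * ζ ^ 5 + (22 : K) * ζ ^ 6 + (13 : K) * ζ ^ 20 + (4 : K) * ζ ^ 21 + (-21 : K) * ζ ^ 22 + (13 : K) * ζ ^ 23 + (3 : K) * ζ ^ 24 + (-20 : K) * ζ ^ 25 + (13 : K) * ζ ^ 26 + (2 : K) * ζ ^ 27 + (-19 : K) * ζ ^ 28 + (13 : K) * ζ ^ 29 + (1 : K) * ζ ^ 30 + (-18 : K) * ζ ^ 31 + (13 : K) * ζ ^ 32 + (13 : K) * ζ ^ 33 + (-13 : K) * ζ ^ 34 + (-8 : K) * ζ ^ 35 + (12 : K) * ζ ^ 36 + (-13 : K) * ζ ^ 37 + (-7 : K) * ζ ^ 38 + (11 : K) * ζ ^ 39 + (-13 : K) * ζ ^ 40 + (-6 : K) * ζ ^ 41 + (23 : K) * ζ ^ 42 + (-13 : K) * ζ ^ 43 + (-5 : K) * ζ ^ 44 + (22 : K) * ζ ^ 45) * hM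
  · -- `α` is a combination of the products
    rw [Ideal.span_singleton_le_iff_mem]
    have heq : hζ.toInteger ^ 17 * (1 - hζ.toInteger ^ 2) * (1 - hζ.toInteger ^ 42) =
        (2 * hζ.toInteger ^ 17 * (1 - hζ.toInteger ^ 2)) * ((1 - hζ.toInteger ^ 3) * (4 + hζ.toInteger ^ 26)) +
        (-2 * hζ.toInteger ^ 20 * (1 - hζ.toInteger ^ 2)) * ((4 + hζ.toInteger ^ 13) * (1 - hζ.toInteger ^ 36)) +
        (-(hζ.toInteger ^ 17 * (1 - hζ.toInteger ^ 2) * (1 - hζ.toInteger ^ 3))) * ((4 + hζ.toInteger ^ 13) * (4 + hζ.toInteger ^ 26)) := by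
      apply RingOfIntegers.ext
      push_cast; simp only [map_ofNat, hzK]
      linear_combination ((-2 : K) * ζ ^ 5 + (-2 : K) * ζ ^ 6 + (2 : K) * ζ ^ 8 + (2 : K) * ζ ^ 9 + (2 : K) * ζ ^ 17 + (2 : K) * ζ ^ 18 + (-2 : K) * ζ ^ 20 + (-2 : K) * ζ ^ 21) * hA + ((2 : K) * ζ ^ 4 + (2 : K) * ζ ^ 5 + (-4 : K) * ζ ^ 7 + (-4 : K) * ζ ^ 8 + (2 : K) * ζ ^ 10 + (2 : K) * ζ ^ 11) * hB + ((2 : K) * ζ ^ 4 + (-2 : K) * ζ ^ 6 + (-2 : K) * ζ ^ 7 + (2 : K) * ζ ^ 9 + (-7 : K) * ζ ^ 17 + (7 : K) * ζ ^ 19 + (-2 : K) * ζ ^ 20 + (2 : K) * ζ ^ 22 + (-2 : K) * ζ ^ 30 + (2 : K) * ζ ^ 32) * hM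
    rw [heq]
    exact Ideal.add_mem _ (Ideal.add_mem _ (Ideal.mul_mem_left _ _ (Ideal.subset_span (by simp)))
      (Ideal.mul_mem_left _ _ (Ideal.subset_span (by simp)))) (Ideal.mul_mem_left _ _ (Ideal.subset_span (by simp)))

/-- **`𝔔𝔔^ρ = (α)` as fractional ideals**: for any invertible `𝔪` with `𝔪 = 𝔔` (as a fractional ideal), `𝔪𝔪^ρ = (α)`. [folklore] -/
theorem mul_conjIdeal_eq_of_coe_eq (hζ : IsPrimitiveRoot ζ 39) (𝔪 : (FractionalIdeal (𝓞 K)⁰ K)ˣ)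
    (h : (𝔪 : FractionalIdeal (𝓞 K)⁰ K) = ((𝔔[hζ] : Ideal (𝓞 K)) : FractionalIdeal (𝓞 K)⁰ K)) :
    (𝔪 : FractionalIdeal (𝓞 K)⁰ K) * (CMTypeLattice.conjIdeal 𝔪 : FractionalIdeal (𝓞 K)⁰ K) = spanSingleton (𝓞 K)⁰ α := by
  rw [CMTypeLattice.coe_conjIdeal, h, AmbiguousClass.fracIdealAut, AmbiguousClass.ringEquivOfRingEquiv_coeIdeal,
    ← coeIdeal_mul, span_mul_map_conj_eq hζ, coeIdeal_span_singleton]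
  rfl

/-- **`𝔔` is an invertible lattice**: some `𝔪 : (FractionalIdeal (𝓞 K)⁰ K)ˣ` has `𝔪 = 𝔔` (`𝔔 ∋ α ≠ 0`). [folklore] -/
theorem exists_units_coe_eq (hζ : IsPrimitiveRoot ζ 39) :
    ∃ 𝔪 : (FractionalIdeal (𝓞 K)⁰ K)ˣ, (𝔪 : FractionalIdeal (𝓞 K)⁰ K) = ((𝔔[hζ] : Ideal (𝓞 K)) : FractionalIdeal (𝓞 K)⁰ K) := by
  have hne : (𝔔[hζ] : Ideal (𝓞 K)) ≠ ⊥ := by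
    intro hbot
    have h := span_mul_map_conj_eq hζ
    rw [hbot, Ideal.bot_mul, eq_comm, Ideal.span_singleton_eq_bot] at h
    have h' := congrArg (fun x : 𝓞 K => (x : K)) h
    have hzK : algebraMap (𝓞 K) K hζ.toInteger = ζ := rfl
    push_cast at h'
    simp only [hzK] at h'
    exact (alpha_real_ne_zero hζ).2 h'
  exact ⟨Units.mk0 _ (coeIdeal_ne_zero.mpr hne), rfl⟩

open scoped Classical in
/-- **THE NON-PRINCIPAL LATTICE CLASS AT `39`, DECIDED**: for every CM type `Φ`, `ℂ^Φ/Φ(𝔔)` (`𝔔 = (1 − ζ³, 4 + ζ¹³)`) carries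
an `ι`-compatible principal polarisation **iff `|S_Φ ∩ N_odd ∩ C₊|` and `|S_Φ ∩ N_odd ∖ C₊|` are both ODD**.
research route conditional on HC_CM; not a corollary; Q11.4-sentence-2 already refuted in dim ≥ 3. [cite: Shimura1998, §14.3 Prop. 5, p. 104; §14.4 Prop. 7, p. 105] -/
theorem principal_iff_odd_thirtyNine_nonprincipal [IsCyclotomicExtension {39} ℚ K] (hζ : IsPrimitiveRoot ζ 39) (Φ : CMType K)
    (𝔪 : (FractionalIdeal (𝓞 K)⁰ K)ˣ)
    (h : (𝔪 : FractionalIdeal (𝓞 K)⁰ K) = ((𝔔[hζ] : Ideal (𝓞 K)) : FractionalIdeal (𝓞 K)⁰ K)) :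
    (∃ ζ' : K, IsCMField.complexConj K ζ' = -ζ' ∧ (∀ φ : Φ.1, 0 < (φ.1 ζ').im) ∧
        CMTypeLattice.IsOfType 𝔪 ζ' ⊤) ↔
      (Odd (((𝐒 Φ ∩ Nodd39).filter fun t => t ∈ Cp39).card) ∧
        Odd (((𝐒 Φ ∩ Nodd39).filter fun t => t ∉ Cp39).card)) :=
  principal_iff_odd_of_mul_conjIdeal_eq hζ Φ 𝔪 (mul_conjIdeal_eq_of_coe_eq hζ 𝔪 h)

open scoped Classical in
/-- **`𝔔 = (1 − ζ³, 4 + ζ¹³)` is NOT a principal ideal of `𝓞 ℚ(ζ₃₉)`.**  If `𝔔 = (g)`, a principal lattice repeats the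
verdict of `ℤ[ζ₃₉]` (part 42 §4); at the CM type `Φ₀` with `S_{Φ₀} = N_odd` both twisted counts are `6`: principally
polarisable on `ℤ[ζ₃₉]` (part 41), not on `𝔔` (§4) — contradiction.  (Signature proof of `h(ℚ(ζ₃₉)) > 1`.)
research route conditional on HC_CM; not a corollary; Q11.4-sentence-2 already refuted in dim ≥ 3. [cite: Washington1997, tables §11] -/
theorem not_isPrincipal_thirtyNine [IsCyclotomicExtension {39} ℚ K] (hζ : IsPrimitiveRoot ζ 39) : ¬ (𝔔[hζ] : Ideal (𝓞 K)).IsPrincipal := by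
  classical
  rintro ⟨g, hg⟩
  obtain ⟨𝔪, h𝔪⟩ := exists_units_coe_eq hζ
  have hg' : (𝔪 : FractionalIdeal (𝓞 K)⁰ K) = spanSingleton (𝓞 K)⁰ (g : K) := by
    rw [h𝔪, show (𝔔[hζ] : Ideal (𝓞 K)) = Ideal.span {g} from hg, coeIdeal_span_singleton]
  have hg0 : (g : K) ≠ 0 := by
    intro h0
    have : (𝔪 : FractionalIdeal (𝓞 K)⁰ K) = 0 := by rw [hg', h0, spanSingleton_zero]
    exact Units.ne_zero 𝔪 this
  -- the CM type with residue set `N_odd`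
  obtain ⟨-, -, -, -, hNoddSet, -, -, -, -⟩ := classes_thirtyNine
  obtain ⟨Φ₀, hΦ₀⟩ := exists_cmType_iff_mem (K := K) hζ hNoddSet
  have hS0 : 𝐒 Φ₀ = ({1, 4, 7, 10, 14, 17, 20, 23, 28, 31, 34, 37} : Finset (ZMod 39)) := by
    ext t
    simp only [mem_filter, mem_univ, true_and]
    constructor
    · rintro ⟨σ, hσ, hσt⟩
      obtain ⟨t', ht', hσt'⟩ := (hΦ₀ σ).mp hσ
      rwa [ZMod.injective_toCircle (Circle.ext (hσt.symm.trans hσt'))]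
    · intro ht
      obtain ⟨σ, hσ⟩ := exists_embedding_apply_eq_toCircle hζ t (hNoddSet.1 t ht)
      exact ⟨σ, (hΦ₀ σ).mpr ⟨t, ht, hσ⟩, hσ⟩
  have h1 := (exists_pos_isOfType_iff_of_eq_spanSingleton Φ₀ 𝔪 hg0 hg' ⊤).mpr
    ((principal_iff_thirtyNine hζ Φ₀).mpr (by rw [hS0, nodd_thirtyNine_eq]; decide))
  have h2 := (principal_iff_odd_thirtyNine_nonprincipal hζ Φ₀ 𝔪 h𝔪).mp h1
  rw [hS0, nodd_thirtyNine_eq] at h2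
  revert h2
  decide

/-! ### §5 Every CM type with counts of equal parity is principally polarisable on `ℤ[ζ₃₉]` or on `𝔔` -/

open scoped Classical in
/-- **EVERY CM TYPE WHOSE TWO TWISTED COUNTS HAVE THE SAME PARITY IS THE TYPE OF A PRINCIPALLY POLARISED SIMPLE CM ABELIAN
VARIETY WITH CM BY `ℤ[ζ₃₉]`** — on the principal lattice if both counts are even (part 41), on `𝔔` if both are odd (§4).  All
`K`-balanced types of the census rows `(39, ℚ(√−3))`, `(39, ℚ(√−39))` have counts of equal parity (b01.39 (D)): the «452 NO»
classes there are NO on `ℤ[ζ₃₉]` and YES on `𝔔`.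
research route conditional on HC_CM; not a corollary; Q11.4-sentence-2 already refuted in dim ≥ 3. [cite: Shimura1998, §14.3 Prop. 4–5, pp. 103–104] -/
theorem exists_principal_on_some_lattice_thirtyNine [IsCyclotomicExtension {39} ℚ K] (hζ : IsPrimitiveRoot ζ 39) (Φ : CMType K)
    (hpar : ((𝐒 Φ ∩ Nodd39).filter fun t => t ∈ Cp39).card % 2 = ((𝐒 Φ ∩ Nodd39).filter fun t => t ∉ Cp39).card % 2) :
    ∃ 𝔪 : (FractionalIdeal (𝓞 K)⁰ K)ˣ,
      ((𝔪 : FractionalIdeal (𝓞 K)⁰ K) = 1 ∨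
        (𝔪 : FractionalIdeal (𝓞 K)⁰ K) = ((𝔔[hζ] : Ideal (𝓞 K)) : FractionalIdeal (𝓞 K)⁰ K)) ∧
      ∃ ζ' : K, IsCMField.complexConj K ζ' = -ζ' ∧ (∀ φ : Φ.1, 0 < (φ.1 ζ').im) ∧ CMTypeLattice.IsOfType 𝔪 ζ' ⊤ := by
  rcases Nat.even_or_odd (((𝐒 Φ ∩ Nodd39).filter fun t => t ∈ Cp39).card) with he | ho
  · refine ⟨1, Or.inl rfl, (principal_iff_thirtyNine hζ Φ).mpr ⟨he, Nat.even_iff.mpr ?_⟩⟩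
    have := Nat.even_iff.mp he; omega
  · obtain ⟨𝔪, h𝔪⟩ := exists_units_coe_eq hζ
    refine ⟨𝔪, Or.inr h𝔪, (principal_iff_odd_thirtyNine_nonprincipal hζ Φ 𝔪 h𝔪).mpr ⟨ho, Nat.odd_iff.mpr ?_⟩⟩
    have := Nat.odd_iff.mp ho; omega

end Lattice

end Summit.HodgeConjecture.Ring2WeilCoverage.NonPrincipalLatticeLevel39

end
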